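import Summits.QuantumFields.YangMills.Theorems.ColdStartUniversalityLatticeLangevinFramePointwiseBochner
import HarnessLib

/-!
# Route `ColdStartUniversality` (fixed-cut-off package, Bakry–Émery side, WEIGHTED gradient bounds): the POINTWISE BOCHNER
# FORMULA for a frame generator with a WEIGHTED carré du champ `Γ^w(h) = Σ_n w_n (W_n h)²`

Helper file (seat `ym-line-csu-p1`, g43; `--supports stmt-QuantumFields-24809`).  Abstract setting of `…FrameCalculus` /
`…FramePointwiseBochner` (frame `s : ι → E →L[ℝ] E` of linear fields with brackets `s_m(s_n y) − s_n(s_m y) = Σ_k c_{nmk} s_k y`,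
`c` antisymmetric in its last two slots, potential `ψ`, `W_n f (y) = Df(y)[s_n y]`, `𝓛f = Σ_n (W_nW_n f + W_nψ · W_n f)`), now with
WEIGHTS `w : ι → ℝ` such that fields of different weight commute, `(w_n − w_m) • (s_m(s_n y) − s_n(s_m y)) = 0` (hypothesis `hw`; for
the noise frame of the SU(2) lattice Langevin dynamics of Shen–Zhu–Zhu: every weight constant on the three fields of a link).
WEIGHTED carré du champ `Γ^w(h) = Σ_n w_n (W_n h)²`.  Contents: §1 `fderiv_wcarre_apply`, `frameDeriv_frameDeriv_wcarre`; §2 the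
cancellations of `…FrameCalculus` with GENERAL coefficient vectors, the weight-exchange identities under `hw` and the weighted curvature
bookkeeping `quarter_sum_sum_wsq_bracket_le` (`¼ Σ_{n,m} w_m (Dh[s_m s_n y − s_n s_m y])² ≤ Σ_{n,m} w_n (W_mW_n h)²`, `w ≥ 0`);
§3 ★★ `frameGammaTwo_pointwise_weighted` — BOCHNER'S FORMULA WITH WEIGHTS, POINTWISE (`h ∈ C³`, `ψ ∈ C²`):
    `½ 𝓛(Γ^w h) − Γ^w(h, 𝓛h) = Σ_{n,m} w_n (W_mW_n h)² − Σ_{n,m} w_n W_nh · W_mh · W_nW_mψ`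
(third-order terms cancel for any weight, first-order drift terms because fields of different weight commute) — the `Γ₂`-type identity
behind WEIGHTED gradient bounds `Γ^w(P_t f) ≤ e^{−2κt} P_t Γ^w f`, the analytic form of Shen–Zhu–Zhu's weighted-distance coupling
estimate (CMP 400 (2023) Lemma 5.1, (5.13); Bakry–Gentil–Ledoux 2014, (1.16.3), (C.5.3)).
THEOREMS ONLY, no definition, no sorry; all [folklore].  HONEST FRAMING: abstract calculus; no statement about Yang–Mills; nothing
K-uniform; the YM mass gap is NOT proved.
-/

set_option autoImplicit false

noncomputable section

namespace Summit.QuantumFields.YangMills.Theorems.ColdStartUniversality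

open Finset MeasureTheory
open scoped BigOperators

variable {E : Type*} [NormedAddCommGroup E] [NormedSpace ℝ E]
variable {ι : Type*} [Fintype ι]

/-! ## §1. Pointwise calculus of the weighted carré du champ -/

/-- `∂_v (Σ_m w_m (W_m h)²) = Σ_m 2 w_m W_mh · ∂_v(W_mh)` for `h ∈ C²`. [folklore] -/
theorem fderiv_wcarre_apply {h : E → ℝ} (hh : ContDiff ℝ 2 h) (s : ι → E →L[ℝ] E) (w : ι → ℝ) (y v : E) :
    fderiv ℝ (fun z => ∑ m, w m * (fderiv ℝ h z (s m z)) ^ 2) y v =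
      ∑ m, 2 * w m * fderiv ℝ h y (s m y) * fderiv ℝ (fun z => fderiv ℝ h z (s m z)) y v := by
  have hd : ∀ m, DifferentiableAt ℝ (fun z => fderiv ℝ h z (s m z)) y := fun m => differentiableAt_frameDeriv hh (s m) y
  have h1 : (fun z => ∑ m, w m * (fderiv ℝ h z (s m z)) ^ 2) =
      fun z => ∑ m, w m * (fderiv ℝ h z (s m z) * fderiv ℝ h z (s m z)) := by
    funext z; simp only [sq]
  rw [h1, fderiv_sum_mul_apply Finset.univ w (f := fun m z => fderiv ℝ h z (s m z) * fderiv ℝ h z (s m z))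
    (fun m _ => (hd m).mul (hd m)) v]
  refine Finset.sum_congr rfl fun m _ => ?_
  rw [fderiv_mul_apply_dir (hd m) (hd m)]
  ring

/-- `W_nW_n (Σ_m w_m (W_m h)²) = Σ_m w_m (2 (W_nW_m h)² + 2 W_mh · W_nW_nW_m h)` for `h ∈ C³`. [folklore] -/
theorem frameDeriv_frameDeriv_wcarre {h : E → ℝ} (hh : ContDiff ℝ 3 h) (s : ι → E →L[ℝ] E) (w : ι → ℝ) (n : ι) (y : E) :
    fderiv ℝ (fun z => fderiv ℝ (fun z' => ∑ m, w m * (fderiv ℝ h z' (s m z')) ^ 2) z (s n z)) y (s n y) =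
      ∑ m, w m * (2 * (fderiv ℝ (fun z => fderiv ℝ h z (s m z)) y (s n y)) ^ 2 +
        2 * fderiv ℝ h y (s m y) *
          fderiv ℝ (fun z => fderiv ℝ (fun z' => fderiv ℝ h z' (s m z')) z (s n z)) y (s n y)) := by
  have hh2 : ContDiff ℝ 2 h := hh.of_le (by norm_num)
  have hW2 : ∀ m, ContDiff ℝ 2 (fun z => fderiv ℝ h z (s m z)) := fun m => contDiff_frameDeriv (k := 2) hh (s m)
  have hWW1 : ∀ m, ContDiff ℝ 1 (fun z => fderiv ℝ (fun z' => fderiv ℝ h z' (s m z')) z (s n z)) :=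
    fun m => contDiff_frameDeriv (k := 1) (hW2 m) (s n)
  have hfun : (fun z => fderiv ℝ (fun z' => ∑ m, w m * (fderiv ℝ h z' (s m z')) ^ 2) z (s n z)) =
      fun z => ∑ m, (2 * w m) * (fderiv ℝ h z (s m z) *
        fderiv ℝ (fun z' => fderiv ℝ h z' (s m z')) z (s n z)) := by
    funext z
    rw [fderiv_wcarre_apply hh2 s w z (s n z)]
    refine Finset.sum_congr rfl fun m _ => ?_
    ring
  rw [hfun]
  have hd1 : ∀ m, DifferentiableAt ℝ (fun z => fderiv ℝ h z (s m z)) y :=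
    fun m => differentiableAt_frameDeriv hh2 (s m) y
  have hd2 : ∀ m, DifferentiableAt ℝ (fun z => fderiv ℝ (fun z' => fderiv ℝ h z' (s m z')) z (s n z)) y :=
    fun m => ((hWW1 m).differentiable (by norm_num)).differentiableAt
  rw [fderiv_sum_mul_apply Finset.univ (fun m => 2 * w m)
    (f := fun m z => fderiv ℝ h z (s m z) * fderiv ℝ (fun z' => fderiv ℝ h z' (s m z')) z (s n z))
    (fun m _ => (hd1 m).mul (hd2 m)) (s n y)]
  refine Finset.sum_congr rfl fun m _ => ?_
  rw [fderiv_mul_apply_dir (hd1 m) (hd2 m)]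
  ring

/-! ## §2. Cancellations with general coefficients; weight exchange -/

section Algebra

/-- **Cancellation I with a general coefficient vector** (`C³`): `Σ_{n,m} a_n · (W_n W_m W_m g − W_m W_m W_n g) = 0` for EVERY
coefficient vector `a` — the third-order commutator term `Σ_n a_n [W_n, Σ_m W_m²] g` of Bochner's formula vanishes for a frame with
antisymmetric structure tensor, whatever multiplies the outer index. [folklore] -/
theorem sum_sum_mul_comm_sq_eq_zero_of_coeff {g : E → ℝ} (hg : ContDiff ℝ 3 g) (s : ι → E →L[ℝ] E)
    (c : ι → ι → ι → ℝ) (hs : ∀ n m y, s m (s n y) - s n (s m y) = ∑ k, c n m k • s k y)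
    (hc : ∀ n m k, c n m k = -c n k m) (a : ι → ℝ) (y : E) :
    ∑ n, ∑ m, a n *
      (fderiv ℝ (fun z => fderiv ℝ (fun w => fderiv ℝ g w (s m w)) z (s m z)) y (s n y) -
        fderiv ℝ (fun z => fderiv ℝ (fun w => fderiv ℝ g w (s n w)) z (s m z)) y (s m y)) = 0 := by
  have hg2 : ContDiff ℝ 2 g := hg.of_le (by norm_num)
  have hW2 : ∀ m, ContDiff ℝ 2 (fun w => fderiv ℝ g w (s m w)) := fun m => contDiff_frameDeriv (k := 2) hg (s m)
  have hW1 : ∀ m n, ContDiff ℝ 1 (fun z => fderiv ℝ (fun w => fderiv ℝ g w (s m w)) z (s n z)) :=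
    fun m n => contDiff_frameDeriv (k := 1) (hW2 m) (s n)
  have hpair : ∀ n m,
      fderiv ℝ (fun z => fderiv ℝ (fun w => fderiv ℝ g w (s m w)) z (s m z)) y (s n y) -
        fderiv ℝ (fun z => fderiv ℝ (fun w => fderiv ℝ g w (s n w)) z (s m z)) y (s m y) =
      ∑ k, c n m k * (fderiv ℝ (fun z => fderiv ℝ g z (s m z)) y (s k y) +
        fderiv ℝ (fun z => fderiv ℝ g z (s k z)) y (s m y)) := by
    intro n m
    have hA := frameDeriv_comm_of_bracket (hW2 m) s c hs n m y
    have hfun : (fun z => fderiv ℝ (fun w => fderiv ℝ g w (s m w)) z (s n z) -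
        fderiv ℝ (fun w => fderiv ℝ g w (s n w)) z (s m z)) = fun z => ∑ k, c n m k * fderiv ℝ g z (s k z) := by
      funext z; exact frameDeriv_comm_of_bracket hg2 s c hs n m z
    have hB : fderiv ℝ (fun z => fderiv ℝ (fun w => fderiv ℝ g w (s m w)) z (s n z)) y (s m y) -
        fderiv ℝ (fun z => fderiv ℝ (fun w => fderiv ℝ g w (s n w)) z (s m z)) y (s m y) =
        ∑ k, c n m k * fderiv ℝ (fun z => fderiv ℝ g z (s k z)) y (s m y) := by
      have hd1 : DifferentiableAt ℝ (fun z => fderiv ℝ (fun w => fderiv ℝ g w (s m w)) z (s n z)) y :=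
        ((hW1 m n).differentiable (by norm_num)).differentiableAt
      have hd2 : DifferentiableAt ℝ (fun z => fderiv ℝ (fun w => fderiv ℝ g w (s n w)) z (s m z)) y :=
        ((hW1 n m).differentiable (by norm_num)).differentiableAt
      have h1 := fderiv_fun_sub hd1 hd2
      have h2 : fderiv ℝ (fun z => fderiv ℝ (fun w => fderiv ℝ g w (s m w)) z (s n z) -
          fderiv ℝ (fun w => fderiv ℝ g w (s n w)) z (s m z)) y (s m y) =
          ∑ k, c n m k * fderiv ℝ (fun z => fderiv ℝ g z (s k z)) y (s m y) := by
        rw [hfun]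
        exact fderiv_sum_mul_apply Finset.univ (c n m) (fun k _ => differentiableAt_frameDeriv hg2 (s k) y) (s m y)
      rw [h1, _root_.sub_apply] at h2
      exact h2
    have hsplit : fderiv ℝ (fun z => fderiv ℝ (fun w => fderiv ℝ g w (s m w)) z (s m z)) y (s n y) -
        fderiv ℝ (fun z => fderiv ℝ (fun w => fderiv ℝ g w (s n w)) z (s m z)) y (s m y) =
        (fderiv ℝ (fun z => fderiv ℝ (fun w => fderiv ℝ g w (s m w)) z (s m z)) y (s n y) -
          fderiv ℝ (fun z => fderiv ℝ (fun w => fderiv ℝ g w (s m w)) z (s n z)) y (s m y)) +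
        (fderiv ℝ (fun z => fderiv ℝ (fun w => fderiv ℝ g w (s m w)) z (s n z)) y (s m y) -
          fderiv ℝ (fun z => fderiv ℝ (fun w => fderiv ℝ g w (s n w)) z (s m z)) y (s m y)) := by ring
    rw [hsplit, hA, hB, ← Finset.sum_add_distrib]
    refine Finset.sum_congr rfl fun k _ => ?_
    ring
  simp_rw [hpair]
  exact sum_sum_mul_sum_antisymm_symm_eq_zero a
    (fun k m => fderiv ℝ (fun z => fderiv ℝ g z (s m z)) y (s k y)) c hc

/-- **Cancellation II with a general drift coefficient**: `Σ_{n,m} W_n g · b_m · (W_m W_n g − W_n W_m g) = 0` for every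
`b : ι → ℝ` (in Bochner's formula `b_m = W_mψ`; here `b` is arbitrary, which is what a weight constant on bracket classes needs).
[folklore] -/
theorem sum_sum_frameDeriv_mul_coeff_comm_eq_zero {g : E → ℝ} (hg : ContDiff ℝ 2 g) (s : ι → E →L[ℝ] E)
    (c : ι → ι → ι → ℝ) (hs : ∀ n m y, s m (s n y) - s n (s m y) = ∑ k, c n m k • s k y)
    (hc : ∀ n m k, c n m k = -c n k m) (b : ι → ℝ) (y : E) :
    ∑ n, ∑ m, fderiv ℝ g y (s n y) * b m *
      (fderiv ℝ (fun z => fderiv ℝ g z (s n z)) y (s m y) - fderiv ℝ (fun z => fderiv ℝ g z (s m z)) y (s n y)) = 0 := by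
  have hpair : ∀ n m, fderiv ℝ (fun z => fderiv ℝ g z (s n z)) y (s m y) -
      fderiv ℝ (fun z => fderiv ℝ g z (s m z)) y (s n y) = ∑ k, c m n k * fderiv ℝ g y (s k y) :=
    fun n m => frameDeriv_comm_of_bracket hg s c hs m n y
  simp_rw [hpair]
  exact sum_sum_mul_mul_sum_antisymm_eq_zero (fun n => fderiv ℝ g y (s n y)) b c hc

omit [Fintype ι] in
/-- **Weight exchange across a commutator.**  If fields of different weight commute (`hw`), then for `g ∈ C²`
`(w_n − w_m)·(W_m W_n g − W_n W_m g) = 0` at every point (second derivatives are symmetric, `frameDeriv_comm`). [folklore] -/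
theorem weight_sub_mul_comm_eq_zero {g : E → ℝ} (hg : ContDiff ℝ 2 g) (s : ι → E →L[ℝ] E) (w : ι → ℝ)
    (hw : ∀ n m y, (w n - w m) • (s m (s n y) - s n (s m y)) = (0 : E)) (n m : ι) (y : E) :
    (w n - w m) * (fderiv ℝ (fun z => fderiv ℝ g z (s n z)) y (s m y) -
      fderiv ℝ (fun z => fderiv ℝ g z (s m z)) y (s n y)) = 0 := by
  rw [frameDeriv_comm hg (s n) (s m) y, ← smul_eq_mul, ← map_smul]
  have h : (w n - w m) • (s n (s m y) - s m (s n y)) = (0 : E) := by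
    rw [show w n - w m = -(w m - w n) by ring, neg_smul, hw m n y, neg_zero]
  rw [h, map_zero]

/-- **Weighted symmetry of the squared second frame derivatives**: under `hw`,
`Σ_{n,m} w_n (W_m W_n g)² = Σ_{n,m} w_m (W_m W_n g)²` (`g ∈ C²`): pairs of equal weight are exchanged by renaming, pairs of
different weight have `W_mW_n g = W_nW_m g`. [folklore] -/
theorem sum_sum_weight_sq_comm {g : E → ℝ} (hg : ContDiff ℝ 2 g) (s : ι → E →L[ℝ] E) (w : ι → ℝ)
    (hw : ∀ n m y, (w n - w m) • (s m (s n y) - s n (s m y)) = (0 : E)) (y : E) :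
    ∑ n, ∑ m, w n * (fderiv ℝ (fun z => fderiv ℝ g z (s n z)) y (s m y)) ^ 2 =
      ∑ n, ∑ m, w m * (fderiv ℝ (fun z => fderiv ℝ g z (s n z)) y (s m y)) ^ 2 := by
  obtain ⟨T, hT⟩ : ∃ T : ι → ι → ℝ, T = fun n m => fderiv ℝ (fun z => fderiv ℝ g z (s n z)) y (s m y) := ⟨_, rfl⟩
  have hTnm : ∀ n m, fderiv ℝ (fun z => fderiv ℝ g z (s n z)) y (s m y) = T n m := fun n m => by rw [hT]
  simp_rw [hTnm]
  -- `(w_n − w_m)(T n m − T m n) = 0`, hence `(w_n − w_m)(T n m² − T m n²) = 0`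
  have hx : ∀ n m, (w n - w m) * T n m ^ 2 = (w n - w m) * T m n ^ 2 := by
    intro n m
    have h := weight_sub_mul_comm_eq_zero hg s w hw n m y
    rw [hTnm, hTnm] at h
    linear_combination (T n m + T m n) * h
  have hD' : ∑ n, ∑ m, (w n - w m) * T m n ^ 2 = -∑ n, ∑ m, (w n - w m) * T n m ^ 2 := by
    rw [Finset.sum_comm, ← Finset.sum_neg_distrib]
    refine Finset.sum_congr rfl fun n _ => ?_
    rw [← Finset.sum_neg_distrib]
    exact Finset.sum_congr rfl fun m _ => by ring
  have hD : ∑ n, ∑ m, (w n - w m) * T n m ^ 2 = ∑ n, ∑ m, (w n - w m) * T m n ^ 2 :=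
    Finset.sum_congr rfl fun n _ => Finset.sum_congr rfl fun m _ => hx n m
  have hsplit : ∑ n, ∑ m, w n * T n m ^ 2 - ∑ n, ∑ m, w m * T n m ^ 2 = ∑ n, ∑ m, (w n - w m) * T n m ^ 2 := by
    rw [← Finset.sum_sub_distrib]
    refine Finset.sum_congr rfl fun n _ => ?_
    rw [← Finset.sum_sub_distrib]
    exact Finset.sum_congr rfl fun m _ => by ring
  linarith

/-- **Weighted curvature bookkeeping**: for weights `w ≥ 0` compatible with the frame (`hw`) and `g ∈ C²`,
`¼ Σ_{n,m} w_m (Dg[s_m(s_n y) − s_n(s_m y)])² ≤ Σ_{n,m} w_n (W_m W_n g)²` — the weighted squared commutators (which carry the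
weighted Ricci term) are dominated by the weighted full square of second frame derivatives. [folklore] -/
theorem quarter_sum_sum_wsq_bracket_le {g : E → ℝ} (hg : ContDiff ℝ 2 g) (s : ι → E →L[ℝ] E) (w : ι → ℝ)
    (hw0 : ∀ n, 0 ≤ w n) (hw : ∀ n m y, (w n - w m) • (s m (s n y) - s n (s m y)) = (0 : E)) (y : E) :
    (1 / 4 : ℝ) * ∑ n, ∑ m, w m * (fderiv ℝ g y (s m (s n y) - s n (s m y))) ^ 2 ≤
      ∑ n, ∑ m, w n * (fderiv ℝ (fun z => fderiv ℝ g z (s n z)) y (s m y)) ^ 2 := by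
  have hsymm := sum_sum_weight_sq_comm hg s w hw y
  obtain ⟨T, hT⟩ : ∃ T : ι → ι → ℝ, T = fun n m => fderiv ℝ (fun z => fderiv ℝ g z (s n z)) y (s m y) := ⟨_, rfl⟩
  have hTnm : ∀ n m, fderiv ℝ (fun z => fderiv ℝ g z (s n z)) y (s m y) = T n m := fun n m => by rw [hT]
  -- the bracket is `T m n − T n m`
  have hcomm : ∀ n m, fderiv ℝ g y (s m (s n y) - s n (s m y)) = T m n - T n m := by
    intro n m
    rw [← hTnm, ← hTnm]
    exact (frameDeriv_comm hg (s m) (s n) y).symm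
  have hX : ∀ n m, (w m - w n) * (T m n - T n m) = 0 := by
    intro n m
    have h := weight_sub_mul_comm_eq_zero hg s w hw m n y
    rw [hTnm, hTnm] at h
    exact h
  simp_rw [hcomm, hTnm]
  simp_rw [hTnm] at hsymm
  have hle : ∀ n m, w m * (T m n - T n m) ^ 2 ≤ (w m + w n) * (T m n ^ 2 + T n m ^ 2) := by
    intro n m
    have hav : w m * (T m n - T n m) ^ 2 = (1 / 2 : ℝ) * (w m + w n) * (T m n - T n m) ^ 2 := by
      linear_combination (1 / 2 : ℝ) * (T m n - T n m) * hX n m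
    rw [hav]
    have hpos : 0 ≤ w m + w n := add_nonneg (hw0 m) (hw0 n)
    have hsq : (T m n - T n m) ^ 2 ≤ 2 * (T m n ^ 2 + T n m ^ 2) := by nlinarith [sq_nonneg (T m n + T n m)]
    nlinarith
  have hsum : ∑ n, ∑ m, w m * (T m n - T n m) ^ 2 ≤ ∑ n, ∑ m, (w m + w n) * (T m n ^ 2 + T n m ^ 2) :=
    Finset.sum_le_sum fun n _ => Finset.sum_le_sum fun m _ => hle n m
  have e1 : ∑ n, ∑ m, (w m + w n) * (T m n ^ 2 + T n m ^ 2) =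
      2 * ∑ n, ∑ m, w n * T n m ^ 2 + 2 * ∑ n, ∑ m, w m * T n m ^ 2 := by
    have ea : ∑ n, ∑ m, w m * T m n ^ 2 = ∑ n, ∑ m, w n * T n m ^ 2 := Finset.sum_comm
    have eb : ∑ n, ∑ m, w n * T m n ^ 2 = ∑ n, ∑ m, w m * T n m ^ 2 := Finset.sum_comm
    have esplit : ∑ n, ∑ m, (w m + w n) * (T m n ^ 2 + T n m ^ 2) =
        ∑ n, ∑ m, w m * T m n ^ 2 + ∑ n, ∑ m, w n * T m n ^ 2 + ∑ n, ∑ m, w m * T n m ^ 2 + ∑ n, ∑ m, w n * T n m ^ 2 := by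
      rw [← Finset.sum_add_distrib, ← Finset.sum_add_distrib, ← Finset.sum_add_distrib]
      refine Finset.sum_congr rfl fun n _ => ?_
      rw [← Finset.sum_add_distrib, ← Finset.sum_add_distrib, ← Finset.sum_add_distrib]
      refine Finset.sum_congr rfl fun m _ => ?_
      ring
    rw [esplit, ea, eb]
    ring
  rw [e1, ← hsymm] at hsum
  linarith

end Algebra

/-! ## §3. Bochner's formula with weights, pointwise -/

/-- ★★ **Bochner's formula for a frame generator with a WEIGHTED carré du champ, POINTWISE.**  For a frame `s` with bracket
relation `s_m(s_n y) − s_n(s_m y) = Σ_k c_{nmk} s_k y`, `c` antisymmetric in its last two slots, weights `w` with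
`(w_n − w_m)•(s_m(s_n y) − s_n(s_m y)) = 0` (fields of different weight commute), a `C²` potential `ψ` and `h ∈ C³`, at every point `y`:
`½·𝓛(Γ^w h)(y) − Γ^w(h, 𝓛h)(y) = Σ_{n,m} w_n (W_mW_n h (y))² − Σ_{n,m} w_n W_nh(y) W_mh(y) W_nW_mψ(y)`,
where `Γ^w h = Σ_m w_m (W_m h)²`, `𝓛f = Σ_n (W_nW_n f + W_nψ·W_n f)` and `Γ^w(h, 𝓛h) = Σ_n w_n W_nh · W_n(𝓛h)`.
(Weighted `Γ₂`: the curvature term sits in the antisymmetric part of `(W_mW_n h)`, the Hessian of `ψ` is paired with the weight of its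
OUTER derivative; Bakry–Gentil–Ledoux 2014, (1.16.3), (C.5.3); Shen–Zhu–Zhu 2023, (5.13).) [folklore] -/
theorem frameGammaTwo_pointwise_weighted {h ψ : E → ℝ} (hh : ContDiff ℝ 3 h) (hψ : ContDiff ℝ 2 ψ) (s : ι → E →L[ℝ] E)
    (c : ι → ι → ι → ℝ) (hs : ∀ n m y, s m (s n y) - s n (s m y) = ∑ k, c n m k • s k y)
    (hc : ∀ n m k, c n m k = -c n k m) (w : ι → ℝ)
    (hw : ∀ n m y, (w n - w m) • (s m (s n y) - s n (s m y)) = (0 : E)) (y : E) :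
    (1 / 2 : ℝ) * ∑ n, (fderiv ℝ (fun z => fderiv ℝ (fun z' => ∑ m, w m * (fderiv ℝ h z' (s m z')) ^ 2) z (s n z)) y (s n y) +
        fderiv ℝ ψ y (s n y) * fderiv ℝ (fun z' => ∑ m, w m * (fderiv ℝ h z' (s m z')) ^ 2) y (s n y)) -
      ∑ n, w n * fderiv ℝ h y (s n y) *
        fderiv ℝ (fun z => ∑ m, (fderiv ℝ (fun z' => fderiv ℝ h z' (s m z')) z (s m z) +
          fderiv ℝ ψ z (s m z) * fderiv ℝ h z (s m z))) y (s n y) =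
    ∑ n, ∑ m, w n * (fderiv ℝ (fun z => fderiv ℝ h z (s n z)) y (s m y)) ^ 2 -
      ∑ n, ∑ m, w n * fderiv ℝ h y (s n y) * fderiv ℝ h y (s m y) *
        fderiv ℝ (fun z => fderiv ℝ ψ z (s m z)) y (s n y) := by
  have hh2 : ContDiff ℝ 2 h := hh.of_le (by norm_num)
  have hW2 : ∀ m, ContDiff ℝ 2 (fun z => fderiv ℝ h z (s m z)) := fun m => contDiff_frameDeriv (k := 2) hh (s m)
  have hWW1 : ∀ m n, ContDiff ℝ 1 (fun z => fderiv ℝ (fun z' => fderiv ℝ h z' (s m z')) z (s n z)) :=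
    fun m n => contDiff_frameDeriv (k := 1) (hW2 m) (s n)
  have hWψ1 : ∀ m, ContDiff ℝ 1 (fun z => fderiv ℝ ψ z (s m z)) := fun m => contDiff_frameDeriv (k := 1) hψ (s m)
  -- (a), (b): first and second frame derivatives of the weighted carré du champ
  have hA : ∀ n, fderiv ℝ (fun z' => ∑ m, w m * (fderiv ℝ h z' (s m z')) ^ 2) y (s n y) =
      ∑ m, 2 * w m * fderiv ℝ h y (s m y) * fderiv ℝ (fun z => fderiv ℝ h z (s m z)) y (s n y) :=
    fun n => fderiv_wcarre_apply hh2 s w y (s n y)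
  have hB : ∀ n, fderiv ℝ (fun z => fderiv ℝ (fun z' => ∑ m, w m * (fderiv ℝ h z' (s m z')) ^ 2) z (s n z)) y (s n y) =
      ∑ m, w m * (2 * (fderiv ℝ (fun z => fderiv ℝ h z (s m z)) y (s n y)) ^ 2 +
        2 * fderiv ℝ h y (s m y) *
          fderiv ℝ (fun z => fderiv ℝ (fun z' => fderiv ℝ h z' (s m z')) z (s n z)) y (s n y)) :=
    fun n => frameDeriv_frameDeriv_wcarre hh s w n y
  -- (c): frame derivative of the frame generator
  have hC : ∀ n, fderiv ℝ (fun z => ∑ m, (fderiv ℝ (fun z' => fderiv ℝ h z' (s m z')) z (s m z) +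
      fderiv ℝ ψ z (s m z) * fderiv ℝ h z (s m z))) y (s n y) =
      ∑ m, (fderiv ℝ (fun z => fderiv ℝ (fun z' => fderiv ℝ h z' (s m z')) z (s m z)) y (s n y) +
        (fderiv ℝ ψ y (s m y) * fderiv ℝ (fun z => fderiv ℝ h z (s m z)) y (s n y) +
          fderiv ℝ h y (s m y) * fderiv ℝ (fun z => fderiv ℝ ψ z (s m z)) y (s n y))) := by
    intro n
    have hd1 : ∀ m, DifferentiableAt ℝ (fun z => fderiv ℝ (fun z' => fderiv ℝ h z' (s m z')) z (s m z)) y :=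
      fun m => ((hWW1 m m).differentiable (by norm_num)).differentiableAt
    have hd2 : ∀ m, DifferentiableAt ℝ (fun z => fderiv ℝ ψ z (s m z)) y :=
      fun m => ((hWψ1 m).differentiable (by norm_num)).differentiableAt
    have hd3 : ∀ m, DifferentiableAt ℝ (fun z => fderiv ℝ h z (s m z)) y :=
      fun m => ((hW2 m).differentiable (by norm_num)).differentiableAt
    have hd23 : ∀ m, DifferentiableAt ℝ (fun z => fderiv ℝ ψ z (s m z) * fderiv ℝ h z (s m z)) y :=
      fun m => (hd2 m).mul (hd3 m)
    have hd4 : ∀ m, DifferentiableAt ℝ (fun z => fderiv ℝ (fun z' => fderiv ℝ h z' (s m z')) z (s m z) +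
        fderiv ℝ ψ z (s m z) * fderiv ℝ h z (s m z)) y := fun m => (hd1 m).add (hd23 m)
    rw [frameDeriv_sum Finset.univ (f := fun m z => fderiv ℝ (fun z' => fderiv ℝ h z' (s m z')) z (s m z) +
        fderiv ℝ ψ z (s m z) * fderiv ℝ h z (s m z)) (fun m _ => hd4 m)]
    refine Finset.sum_congr rfl fun m _ => ?_
    rw [fderiv_fun_add (hd1 m) (hd23 m), add_apply, fderiv_mul_apply_dir (hd2 m) (hd3 m)]
  -- the two cancellations (weighted coefficient on the outer index) and the weight exchange
  have hI : ∑ n, ∑ m, (w n * fderiv ℝ h y (s n y)) *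
      (fderiv ℝ (fun z => fderiv ℝ (fun z' => fderiv ℝ h z' (s m z')) z (s m z)) y (s n y) -
        fderiv ℝ (fun z => fderiv ℝ (fun z' => fderiv ℝ h z' (s n z')) z (s m z)) y (s m y)) = 0 :=
    sum_sum_mul_comm_sq_eq_zero_of_coeff hh s c hs hc (fun n => w n * fderiv ℝ h y (s n y)) y
  have hII : ∑ n, ∑ m, fderiv ℝ h y (s n y) * (w m * fderiv ℝ ψ y (s m y)) *
      (fderiv ℝ (fun z => fderiv ℝ h z (s n z)) y (s m y) - fderiv ℝ (fun z => fderiv ℝ h z (s m z)) y (s n y)) = 0 :=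
    sum_sum_frameDeriv_mul_coeff_comm_eq_zero (g := h) hh2 s c hs hc (fun m => w m * fderiv ℝ ψ y (s m y)) y
  have hX : ∀ n m, (w n - w m) * (fderiv ℝ (fun z => fderiv ℝ h z (s n z)) y (s m y) -
      fderiv ℝ (fun z => fderiv ℝ h z (s m z)) y (s n y)) = 0 :=
    fun n m => weight_sub_mul_comm_eq_zero hh2 s w hw n m y
  -- named double sums
  set S1 : ℝ := ∑ n, ∑ m, w m * (fderiv ℝ (fun z => fderiv ℝ h z (s m z)) y (s n y)) ^ 2 with hS1
  set S1' : ℝ := ∑ n, ∑ m, w n * (fderiv ℝ (fun z => fderiv ℝ h z (s n z)) y (s m y)) ^ 2 with hS1'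
  set S2 : ℝ := ∑ n, ∑ m, w m * fderiv ℝ h y (s m y) *
    fderiv ℝ (fun z => fderiv ℝ (fun z' => fderiv ℝ h z' (s m z')) z (s n z)) y (s n y) with hS2
  set S2' : ℝ := ∑ n, ∑ m, w n * fderiv ℝ h y (s n y) *
    fderiv ℝ (fun z => fderiv ℝ (fun z' => fderiv ℝ h z' (s n z')) z (s m z)) y (s m y) with hS2'
  set S3 : ℝ := ∑ n, ∑ m, fderiv ℝ ψ y (s n y) * (w m * fderiv ℝ h y (s m y)) *
    fderiv ℝ (fun z => fderiv ℝ h z (s m z)) y (s n y) with hS3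
  set S3' : ℝ := ∑ n, ∑ m, fderiv ℝ ψ y (s m y) * (w n * fderiv ℝ h y (s n y)) *
    fderiv ℝ (fun z => fderiv ℝ h z (s n z)) y (s m y) with hS3'
  set S4 : ℝ := ∑ n, ∑ m, w n * fderiv ℝ h y (s n y) *
    fderiv ℝ (fun z => fderiv ℝ (fun z' => fderiv ℝ h z' (s m z')) z (s m z)) y (s n y) with hS4
  set S5 : ℝ := ∑ n, ∑ m, w n * fderiv ℝ h y (s n y) * fderiv ℝ ψ y (s m y) *
    fderiv ℝ (fun z => fderiv ℝ h z (s m z)) y (s n y) with hS5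
  set S6 : ℝ := ∑ n, ∑ m, w n * fderiv ℝ h y (s n y) * fderiv ℝ h y (s m y) *
    fderiv ℝ (fun z => fderiv ℝ ψ z (s m z)) y (s n y) with hS6
  have e11 : S1 = S1' := Finset.sum_comm
  have e22 : S2 = S2' := Finset.sum_comm
  have e33 : S3 = S3' := Finset.sum_comm
  have hI' : S4 - S2' = 0 := by
    rw [← hI, hS4, hS2', ← Finset.sum_sub_distrib]
    refine Finset.sum_congr rfl fun n _ => ?_
    rw [← Finset.sum_sub_distrib]
    refine Finset.sum_congr rfl fun m _ => ?_
    ring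
  -- `S3' − S5 = Σ w_n W_nh W_mψ (W_mW_n h − W_nW_m h) = Σ W_nh (w_m W_mψ)(…) + Σ W_nh W_mψ (w_n − w_m)(…) = 0 + 0`
  have hII' : S3' - S5 = 0 := by
    rw [← hII, hS3', hS5, ← Finset.sum_sub_distrib]
    refine Finset.sum_congr rfl fun n _ => ?_
    rw [← Finset.sum_sub_distrib]
    refine Finset.sum_congr rfl fun m _ => ?_
    have hx := hX n m
    have e : fderiv ℝ ψ y (s m y) * (w n * fderiv ℝ h y (s n y)) * fderiv ℝ (fun z => fderiv ℝ h z (s n z)) y (s m y) -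
        w n * fderiv ℝ h y (s n y) * fderiv ℝ ψ y (s m y) * fderiv ℝ (fun z => fderiv ℝ h z (s m z)) y (s n y) =
        fderiv ℝ h y (s n y) * (w m * fderiv ℝ ψ y (s m y)) *
          (fderiv ℝ (fun z => fderiv ℝ h z (s n z)) y (s m y) - fderiv ℝ (fun z => fderiv ℝ h z (s m z)) y (s n y)) +
        fderiv ℝ h y (s n y) * fderiv ℝ ψ y (s m y) * ((w n - w m) * (fderiv ℝ (fun z => fderiv ℝ h z (s n z)) y (s m y) -
          fderiv ℝ (fun z => fderiv ℝ h z (s m z)) y (s n y))) := by ring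
    rw [e, hx, mul_zero, add_zero]
  -- the left-hand side in terms of the named sums
  have q1 : ∀ n, ∑ m, w m * (2 * (fderiv ℝ (fun z => fderiv ℝ h z (s m z)) y (s n y)) ^ 2 +
        2 * fderiv ℝ h y (s m y) *
          fderiv ℝ (fun z => fderiv ℝ (fun z' => fderiv ℝ h z' (s m z')) z (s n z)) y (s n y)) =
      2 * ∑ m, w m * (fderiv ℝ (fun z => fderiv ℝ h z (s m z)) y (s n y)) ^ 2 +
        2 * ∑ m, w m * fderiv ℝ h y (s m y) *
          fderiv ℝ (fun z => fderiv ℝ (fun z' => fderiv ℝ h z' (s m z')) z (s n z)) y (s n y) := by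
    intro n
    rw [Finset.mul_sum, Finset.mul_sum, ← Finset.sum_add_distrib]
    exact Finset.sum_congr rfl fun m _ => by ring
  have q2 : ∀ n, fderiv ℝ ψ y (s n y) * ∑ m, 2 * w m * fderiv ℝ h y (s m y) * fderiv ℝ (fun z => fderiv ℝ h z (s m z)) y (s n y) =
      2 * ∑ m, fderiv ℝ ψ y (s n y) * (w m * fderiv ℝ h y (s m y)) * fderiv ℝ (fun z => fderiv ℝ h z (s m z)) y (s n y) := by
    intro n
    rw [Finset.mul_sum, Finset.mul_sum]
    exact Finset.sum_congr rfl fun m _ => by ring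
  have eL1 : (1 / 2 : ℝ) * ∑ n, (fderiv ℝ (fun z => fderiv ℝ (fun z' => ∑ m, w m * (fderiv ℝ h z' (s m z')) ^ 2) z (s n z)) y (s n y) +
        fderiv ℝ ψ y (s n y) * fderiv ℝ (fun z' => ∑ m, w m * (fderiv ℝ h z' (s m z')) ^ 2) y (s n y)) = S1 + S2 + S3 := by
    simp_rw [hB, hA, q1, q2]
    have q3 : ∀ n, 2 * ∑ m, w m * (fderiv ℝ (fun z => fderiv ℝ h z (s m z)) y (s n y)) ^ 2 +
        2 * ∑ m, w m * fderiv ℝ h y (s m y) *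
          fderiv ℝ (fun z => fderiv ℝ (fun z' => fderiv ℝ h z' (s m z')) z (s n z)) y (s n y) +
        2 * ∑ m, fderiv ℝ ψ y (s n y) * (w m * fderiv ℝ h y (s m y)) * fderiv ℝ (fun z => fderiv ℝ h z (s m z)) y (s n y) =
        2 * ((∑ m, w m * (fderiv ℝ (fun z => fderiv ℝ h z (s m z)) y (s n y)) ^ 2) +
          (∑ m, w m * fderiv ℝ h y (s m y) *
            fderiv ℝ (fun z => fderiv ℝ (fun z' => fderiv ℝ h z' (s m z')) z (s n z)) y (s n y)) +
          ∑ m, fderiv ℝ ψ y (s n y) * (w m * fderiv ℝ h y (s m y)) * fderiv ℝ (fun z => fderiv ℝ h z (s m z)) y (s n y)) :=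
      fun n => by ring
    simp_rw [q3]
    rw [← Finset.mul_sum, Finset.sum_add_distrib, Finset.sum_add_distrib, hS1, hS2, hS3]
    ring
  have q4 : ∀ n, w n * fderiv ℝ h y (s n y) *
      ∑ m, (fderiv ℝ (fun z => fderiv ℝ (fun z' => fderiv ℝ h z' (s m z')) z (s m z)) y (s n y) +
        (fderiv ℝ ψ y (s m y) * fderiv ℝ (fun z => fderiv ℝ h z (s m z)) y (s n y) +
          fderiv ℝ h y (s m y) * fderiv ℝ (fun z => fderiv ℝ ψ z (s m z)) y (s n y))) =
      ∑ m, w n * fderiv ℝ h y (s n y) *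
          fderiv ℝ (fun z => fderiv ℝ (fun z' => fderiv ℝ h z' (s m z')) z (s m z)) y (s n y) +
        ∑ m, w n * fderiv ℝ h y (s n y) * fderiv ℝ ψ y (s m y) * fderiv ℝ (fun z => fderiv ℝ h z (s m z)) y (s n y) +
        ∑ m, w n * fderiv ℝ h y (s n y) * fderiv ℝ h y (s m y) * fderiv ℝ (fun z => fderiv ℝ ψ z (s m z)) y (s n y) := by
    intro n
    rw [Finset.mul_sum, ← Finset.sum_add_distrib, ← Finset.sum_add_distrib]
    exact Finset.sum_congr rfl fun m _ => by ring
  have eL2 : ∑ n, w n * fderiv ℝ h y (s n y) *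
        fderiv ℝ (fun z => ∑ m, (fderiv ℝ (fun z' => fderiv ℝ h z' (s m z')) z (s m z) +
          fderiv ℝ ψ z (s m z) * fderiv ℝ h z (s m z))) y (s n y) = S4 + S5 + S6 := by
    simp_rw [hC, q4]
    rw [Finset.sum_add_distrib, Finset.sum_add_distrib, hS4, hS5, hS6]
  rw [eL1, eL2]
  linarith [e11, e22, e33, hI', hII']

end Summit.QuantumFields.YangMills.Theorems.ColdStartUniversality
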